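import Literature.AnabelianGeometry.EtaleTheta.SettingModelTateDeckIterates
import Literature.AnabelianGeometry.EtaleTheta.SettingModelTateDeckDisplay
import HarnessLib

/-!
# The STAGE-2 («Tate shear») model of [EtTh] §1: the deck display of `log(Ü)` at GENERAL even `j` (un-squared),
# and the `σ₀^n` census of `log(Ü)` and of the `z`-class / twist family off the line `j = 2`

S. Mochizuki, *The étale theta function and its Frobenioid-theoretic manifestations*, Publ. RIMS **45** (2009) [EtTh], §1,
Prop. 1.5 (iii), PRIMS PDF p. 23 (printed 249): "… on which `a ∈ Z` acts as follows:
`η̈^Θ ↦ η̈^Θ − 2a·log(Ü) − (a²/2)·log(q_X) + log(O^×_K̈)`, `log(Ü) ↦ log(Ü) + a·log(q_X)/2 + log(O^×_K̈)`"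
[cite: MochizukiEtTh2009, Prop 1.5 (iii) p.23].  Layer L2 of the abc-iut cell, seat abc-iut-L2-t12 gen 12, row «DECK-LOG@GENERAL-j»
(gen-11 HANDOFF open item (i); OFFER #3 to abc-iut-L2-lead gen 9).  PROOF-ONLY (no definition, no instance, no `Prop` fact)
over abc-iut-L2-t6's F7q part 2b (`SettingModelTateDeckDisplay`: the `j = 2` display `conj_deckGen_logUdd` and the `i = 1`
display `conj_deckGen_zClassYddχq`), abc-iut-L2-t6's level law `yCoordχq_deckConj` (stated at GENERAL `(i, j)`), and this seat's
gen-11 `ContH1.conj_zpow_apply_of_mul_zpow` / `conj_zpow_apply_of_display` (`SettingModelTateDeckIterates`).  All BY NAME.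

In the tree the deck display of `log(Ü)` at general even `j` existed only SQUARED (gen-6 `sq_conj_deckGen_logUdd_modelχq`,
`SettingModelTateProp15iiiShearRigidity`); the un-squared form was stated at `j = 2` only.  Here (every `p`, every `i`,
every EVEN `j`, `hC` = the `Compat` structure law; `σ₀ = (a, 1)`, `L = log(Ü)`, `Q = κ̈(q̈)`):
* **`conj_deckGen_logUdd_gen`** — `σ₀·L = L · Q^{j/2} · κ̈(1)`: on cocycles `ŷ(σ₀⁻¹gσ₀)/2 = ŷ(g)/2 + (j/2)·κ_p(g)`, from
  `ŷ(σ₀⁻¹gσ₀) = ŷ(g)·κ_p(g)^j` and injectivity of squaring on `Ẑ`; `j = 2` is abc-iut-L2-t6's `hL₀`;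
* **`conj_toTheta_zpow_deckGen_logUdd_gen`** — `σ₀^n·L = L · Q^{(j/2)·n}` for every `n ∈ ℤ` (gen-11 census at `j = 2`:
  `conj_toTheta_zpow_deckGen_logUdd`);
* at `i = 1`, every even `j` (where abc-iut-L2-t6's `z`-class display `σ₀·x′ = x′·L^{−2}·Q^{−1}·κ̈(1)` is in the tree):
  **`conj_toTheta_zpow_deckGen_zClassYddχq_gen`** — `σ₀^n·x′ = x′ · L^{−2n} · Q^{−(n(n−1)(j/2) + n)}`, and for the twist family
  `x_m := x′·L^m`: **`conj_toTheta_zpow_deckGen_twistLift_gen`** — `σ₀^n·x_m = x_m · L^{−2n} · Q^{−(n(n−1)(j/2) + n − nm(j/2))}`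
  (gen-11 (A) at `j = 2`: `−(n(n−1) + ni − nm)` with `i = 1`).  At `j = 2` print's coefficient «`a²/2`·log(q_X)» is recovered;
  off the line the quadratic coefficient is `j/2` — the shear of OUR model, an artefact of the semi-synthetic datum.

HONEST FRAMING: SEMI-SYNTHETIC model — consistency / non-vacuity evidence for the typed interface ONLY; nothing of [EtTh] is
asserted; inhabited-at-a-model ≠ proved in print; no side is taken on [IUTchIII] Cor. 3.12; nothing here asserts that abc is
proved or refuted.
-/

noncomputable section

namespace Literature.AnabelianGeometry.EtaleTheta.SettingModel

open Literature.AnabelianGeometry.SemiGraphs _root_.Topology _root_.Function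

variable (p : ℕ) [Fact p.Prime] (i j : ℤ)

/-- Exponent bookkeeping: for even `j`, `(j/2)·2 = j` (integer division). [cite: MochizukiEtTh2009, Prop 1.5 (iii) p.23] -/
private theorem ediv_two_mul_two (hj : Even j) : j / 2 * 2 = j := by
  have := Int.two_mul_ediv_two_of_even hj
  omega

/-- **`σ₀·log(Ü) = log(Ü)·κ̈(q̈)^{j/2}·κ̈(1)` at `modelχq p i j`** (every `i`, every EVEN `j`): conjugation by the deck generator
`σ₀ = (a, 1)` on the class `log(Ü) = c^{ŷ/2}` — on cocycles `ŷ(σ₀⁻¹gσ₀)/2 = ŷ(g)/2 + (j/2)·κ_p(g)` (abc-iut-L2-t6's level law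
`yCoordχq_deckConj`: `ŷ(σ₀⁻¹gσ₀) = ŷ(g)·κ_p(g)^j`, un-squared by injectivity of squaring on `Ẑ`).  At `j = 2` this is
abc-iut-L2-t6's `conj_deckGen_logUdd` (print's «`log(Ü) ↦ log(Ü) + log(q_X)/2`», `a = 1`); the trailing `κ̈(1) = 1` keeps the
shape of the binder `hL₀` (unit `u := 1`). [cite: MochizukiEtTh2009, Prop 1.5 (iii) p.23] -/
theorem conj_deckGen_logUdd_gen (hj : Even j) (hC : (ThetaSetting.modelχq p i j hj).Compat) :
    haveI := hC.GtpYddTheta_normal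
    ContH1.conj (MonoidHom.id (ThetaSetting.modelχq p i j hj).GtpTheta)
        (ThetaSetting.modelχq p i j hj).DeltaTheta
        ((ThetaSetting.modelχq p i j hj).toTheta (SemidirectProduct.inl (gfpOf (FreeGroup.of 0))))
        (kummerCoreχq p i j hj).logUdd =
      (kummerCoreχq p i j hj).logUdd *
        (kummerCoreχq p i j hj).toKummerData.kumYdd
          ((kummerCoreχq p i j hj).toKummerData.toKddHat (ThetaSetting.modelχq p i j hj).qddUnit) ^ (j / 2) *
        (kummerCoreχq p i j hj).toKummerData.kumYdd
          ((kummerCoreχq p i j hj).toKummerData.toKddHat 1) := by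
  haveI := hC.GtpYddTheta_normal
  letI := (ThetaSetting.modelχq p i j hj).unitsAction (kummerCoreχq p i j hj).augTheta
  rw [map_one, map_one, mul_one, kumYdd_toKddHat_qddUnit_eq_mk]
  set K := (kummerCoreχq p i j hj).coeff.kummerContCocycle
    ((ThetaSetting.modelχq p i j hj).GtpYdd.map (ThetaSetting.modelχq p i j hj).toTheta)
    ((pRoots p).cast (pUnit_eq_toInvYdd_qddUnit p i j hj))
    ((kummerCoreχq p i j hj).toInvYdd (ThetaSetting.modelχq p i j hj).qddUnit).2
    (fun _ => (kummerCoreχq p i j hj).isOpen_stabilizer' _) with hK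
  change ContH1.conj _ _ _ (ContH1.mk (yCoordKitχq p i j hj).logUddFun (yCoordKitχq p i j hj).logUddFun_mem) =
    ContH1.mk (yCoordKitχq p i j hj).logUddFun (yCoordKitχq p i j hj).logUddFun_mem * ContH1.mk (K ^ (j / 2)).1 (K ^ (j / 2)).2
  rw [ContH1.mk_mul_mk]
  change ContH1.mk (ContH1.conjCocycle _ _ _ ⟨(yCoordKitχq p i j hj).logUddFun,
      (yCoordKitχq p i j hj).logUddFun_mem⟩).1 (ContH1.conjCocycle _ _ _
        ⟨(yCoordKitχq p i j hj).logUddFun, (yCoordKitχq p i j hj).logUddFun_mem⟩).2 = _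
  refine ContH1.mk_congr _ (funext fun h => ?_) _ _
  obtain ⟨g, hg, hgh⟩ := h.2
  have hg0 : gfpSnd g.left = 1 :=
    gfpSnd_left_eq_one_of_mem_gtpY_modelχq p i j hj ((ThetaSetting.modelχq p i j hj).GtpYdd_le_GtpY hg)
  rw [ContH1.conjCocycle_apply, MonoidHom.id_apply, Pi.mul_apply]
  refine (conjNormal_toThetaq_eq_self p i j hj (SemidirectProduct.right_inl _) _).trans ?_
  apply Subtype.ext
  rw [Subgroup.coe_mul, SubgroupClass.coe_zpow, Pi.pow_apply, SubgroupClass.coe_zpow, coe_kummerContCocycle_qdd_apply,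
    coe_logUddFun_yCoordKitχq, coe_logUddFun_yCoordKitχq, ← map_zpow (cThetaχq p i j), ← map_mul (cThetaχq p i j)]
  congr 1
  apply sqHom_injective
  have hc : Commute (half ⟨yThetaχq p i j h.1, (yCoordKitχq p i j hj).y_even h.1 h.2⟩)
      (kappaP p (CurveTheta.augTheta (curveχq p i j) h.1) ^ (j / 2)) :=
    Literature.AnabelianGeometry.AbsoluteAnabelian.ZHatCompletion.mul_comm _ _
  rw [sqHom_apply, sqHom_apply, half_sq, hc.mul_pow, half_sq, ← zpow_natCast (kappaP p _ ^ (j / 2)), ← zpow_mul,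
    Nat.cast_ofNat, ediv_two_mul_two j hj]
  change yThetaχq p i j (MulAut.conjNormal ((ThetaSetting.modelχq p i j hj).toTheta
      (SemidirectProduct.inl (gfpOf (FreeGroup.of 0))))⁻¹ h : _) =
    yThetaχq p i j h.1 * kappaP p (CurveTheta.augTheta (curveχq p i j) h.1) ^ j
  rw [MulAut.conjNormal_apply, inv_inv, ← hgh]
  change yThetaχq p i j ((CurveTheta.toTheta (curveχq p i j) (SemidirectProduct.inl (gfpOf (FreeGroup.of 0))))⁻¹ *
      CurveTheta.toTheta (curveχq p i j) g * CurveTheta.toTheta (curveχq p i j)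
        (SemidirectProduct.inl (gfpOf (FreeGroup.of 0)))) =
    yThetaχq p i j (CurveTheta.toTheta (curveχq p i j) g) *
      kappaP p (CurveTheta.augTheta (curveχq p i j) (CurveTheta.toTheta (curveχq p i j) g)) ^ j
  rw [← map_inv, ← map_mul, ← map_mul, yThetaχq_toTheta, yThetaχq_toTheta, CurveTheta.augTheta_toTheta,
    yCoordχq_deckConj p i j hg0]
  rfl

/-- **`σ₀^n·log(Ü) = log(Ü)·κ̈(q̈)^{(j/2)·n}`** at `modelχq p i j` (every `i`, every even `j`, every `n ∈ ℤ`) — the deck census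
of `log(Ü)` off the line `j = 2` (gen-11's `conj_toTheta_zpow_deckGen_logUdd` is `j = 2`), iterated from the one-step display
by `ContH1.conj_zpow_apply_of_mul_zpow` (`σ₀^n` fixes `Q`: `conj_toTheta_zpow_deckGen_kumYdd_qddUnit`).
[cite: MochizukiEtTh2009, Prop 1.5 (iii) p.23] -/
theorem conj_toTheta_zpow_deckGen_logUdd_gen (hj : Even j) (hC : (ThetaSetting.modelχq p i j hj).Compat) (n : ℤ) :
    haveI := hC.GtpYddTheta_normal
    ContH1.conj (MonoidHom.id (ThetaSetting.modelχq p i j hj).GtpTheta) (ThetaSetting.modelχq p i j hj).DeltaTheta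
        ((ThetaSetting.modelχq p i j hj).toTheta ((SemidirectProduct.inl (gfpOf (FreeGroup.of 0)) : PiTpχq p i j) ^ n))
        (kummerCoreχq p i j hj).logUdd =
      (kummerCoreχq p i j hj).logUdd *
        (kummerCoreχq p i j hj).toKummerData.kumYdd
          ((kummerCoreχq p i j hj).toKummerData.toKddHat (ThetaSetting.modelχq p i j hj).qddUnit) ^ (j / 2 * n) := by
  haveI := hC.GtpYddTheta_normal
  have hL := conj_deckGen_logUdd_gen p i j hj hC
  rw [map_one, map_one, mul_one] at hL
  rw [map_zpow]
  exact ContH1.conj_zpow_apply_of_mul_zpow (conj_kumYdd_qddUnit_of_aug_eq_one p i j hj hC (aug_inl p i j hj _)) hL n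

/-- Exponent bookkeeping for the `z`-class census. [cite: MochizukiEtTh2009, Prop 1.5 (iii) p.23] -/
private theorem zClass_census_exponent (k n : ℤ) : -(n * (n - 1) * k + n * 1) = -(n * (n - 1) * k + n) := by ring

/-- **`σ₀^n·x′ = x′·log(Ü)^{−2n}·κ̈(q̈)^{−(n(n−1)(j/2) + n)}`** at `modelχq p 1 j` (every even `j`, every `n ∈ ℤ`) for the
`z`-class `x′ = zClassYddχq`: the deck census off the line `j = 2` at `i = 1`, iterated by gen-11's
`ContH1.conj_zpow_apply_of_display` (`k := j/2`, `c := 1`) from abc-iut-L2-t6's one-step display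
`σ₀·x′ = x′·log(Ü)^{−2}·κ̈(q̈)^{−1}` (`conj_deckGen_zClassYddχq`, `i = 1`) and `conj_deckGen_logUdd_gen`.  At `j = 2` the
exponent is `−n²` = print's «`−(a²/2)·log(q_X)`», `a = n`. [cite: MochizukiEtTh2009, Prop 1.5 (iii) p.23] -/
theorem conj_toTheta_zpow_deckGen_zClassYddχq_gen (hj : Even j) (hC : (ThetaSetting.modelχq p 1 j hj).Compat) (n : ℤ) :
    haveI := hC.GtpYddTheta_normal
    ContH1.conj (MonoidHom.id (ThetaSetting.modelχq p 1 j hj).GtpTheta) (ThetaSetting.modelχq p 1 j hj).DeltaTheta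
        ((ThetaSetting.modelχq p 1 j hj).toTheta ((SemidirectProduct.inl (gfpOf (FreeGroup.of 0)) : PiTpχq p 1 j) ^ n))
        (zClassYddχq p 1 j hj) =
      zClassYddχq p 1 j hj * (kummerCoreχq p 1 j hj).logUdd ^ (-(2 * n)) *
        (kummerCoreχq p 1 j hj).toKummerData.kumYdd
          ((kummerCoreχq p 1 j hj).toKummerData.toKddHat (ThetaSetting.modelχq p 1 j hj).qddUnit) ^
            (-(n * (n - 1) * (j / 2) + n)) := by
  haveI := hC.GtpYddTheta_normal
  have hL := conj_deckGen_logUdd_gen p 1 j hj hC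
  have hx := conj_deckGen_zClassYddχq p j hj hC
  rw [map_one, map_one, mul_one] at hL hx
  rw [map_zpow, ← zClass_census_exponent]
  exact ContH1.conj_zpow_apply_of_display (conj_kumYdd_qddUnit_of_aug_eq_one p 1 j hj hC (aug_inl p 1 j hj _)) hL hx n

/-- Commutative-group algebra for the twist family: `x_m = x′·L^m` under `σ₀^n`. [cite: MochizukiEtTh2009, Prop 1.5 (iii) p.23] -/
private theorem twistLift_gen_algebra {M : Type*} [CommGroup M] (x L Q : M) (k n m : ℤ) :
    x * L ^ (-(2 * n)) * Q ^ (-(n * (n - 1) * k + n)) * (L * Q ^ (k * n)) ^ m =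
      x * L ^ m * L ^ (-(2 * n)) * Q ^ (-(n * (n - 1) * k + n - n * m * k)) := by
  apply Additive.ofMul.injective
  simp only [ofMul_mul, ofMul_zpow]
  module

/-- **The twist family off the line: `σ₀^n·x_m = x_m·log(Ü)^{−2n}·κ̈(q̈)^{−(n(n−1)(j/2) + n − nm(j/2))}`** at `modelχq p 1 j` for
`x_m := x′·log(Ü)^m` (every even `j`, every `n, m ∈ ℤ`) — gen-11 (A)'s `conj_toTheta_zpow_deckGen_twistLift` is the line `j = 2`
(exponent `−(n(n−1) + ni − nm)` at `i = 1`).  The `Q`-free member (`n = 1`: `−(1 − m(j/2)) = 0`) exists iff `(j/2) ∣ 1`, i.e. only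
on the lines `j = ±2` — the twist-family pin of gen-11 (B) (`m = i − 1` at `j = 2`) read at `i = 1`.
[cite: MochizukiEtTh2009, Prop 1.5 (iii) p.23] -/
theorem conj_toTheta_zpow_deckGen_twistLift_gen (hj : Even j) (hC : (ThetaSetting.modelχq p 1 j hj).Compat) (n m : ℤ) :
    haveI := hC.GtpYddTheta_normal
    ContH1.conj (MonoidHom.id (ThetaSetting.modelχq p 1 j hj).GtpTheta) (ThetaSetting.modelχq p 1 j hj).DeltaTheta
        ((ThetaSetting.modelχq p 1 j hj).toTheta ((SemidirectProduct.inl (gfpOf (FreeGroup.of 0)) : PiTpχq p 1 j) ^ n))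
        (zClassYddχq p 1 j hj * (kummerCoreχq p 1 j hj).logUdd ^ m) =
      zClassYddχq p 1 j hj * (kummerCoreχq p 1 j hj).logUdd ^ m * (kummerCoreχq p 1 j hj).logUdd ^ (-(2 * n)) *
        (kummerCoreχq p 1 j hj).toKummerData.kumYdd
          ((kummerCoreχq p 1 j hj).toKummerData.toKddHat (ThetaSetting.modelχq p 1 j hj).qddUnit) ^
            (-(n * (n - 1) * (j / 2) + n - n * m * (j / 2))) := by
  haveI := hC.GtpYddTheta_normal
  rw [map_mul, (ContH1.conj _ _ _).map_zpow, conj_toTheta_zpow_deckGen_zClassYddχq_gen p j hj hC n,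
    conj_toTheta_zpow_deckGen_logUdd_gen p 1 j hj hC n]
  exact twistLift_gen_algebra _ _ _ (j / 2) n m

end Literature.AnabelianGeometry.EtaleTheta.SettingModel

end
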